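import Mathlib
import Summits.ResolutionOfSingularities.ResolutionOfSingularities.Theorems.WeightedInvariantLocalWeightedDropWildMonicKangarooShiftForms
import Summits.ResolutionOfSingularities.ResolutionOfSingularities.Theorems.WeightedInvariantLocalWeightedDropWildMonicKangarooUnivariate

/-!
# `WeightedInvariant.LocalWeightedDrop`, line `hasse-ridge-face-selection`, S3ρ sub-stub S3ρD₂ `stub_wildMonicSurfaceDescent₂`:
# CASE D-d (KANGAROO), part 6 — Perlega's Prop. 6.2.3 for tuples, the TAME CASES: (∗), `d!·ord_w g > m`, `(1)_w`, and `(2)_w`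

Crux item stmt-ResolutionOfSingularities-8899 `LocalWeightedDrop` (route `ResolutionOfSingularities/WeightedInvariant`), engine of the
door `HypersurfaceCentreConstruction` stmt-ResolutionOfSingularities-19897.  [OURS · L1 W4.3, chain w43, seat res-type-056 on ROADMAP item
(C8) = D-d KANGAROO of `L/res-L1-w43-stub-7/S3RHOD-ROADMAP.md`.  MODEL: S. Perlega, thesis Wien 2017 / arXiv:2011.14443, Ch. 6 §2.1
Prop. 6.2.3 (kangaroo_prop), proof [cite: Perlega2020, Prop. 6.2.3 proof: (∗) «`d(in_w(f_i)) ≤ ((c−i)/c!)·d`»; «If `f` is `ỹ`-clean … then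
`d_* = d₁ ≤ d`»; case `(1)_w`: «`ord_{(y₁)} in_w(f̃_i) = ord_{(y₁)} in_w(f_i) ≤ d(in_w(f_i)) ≤ ((c−i)/c!)·d` … this proves `d_* ≤ d`»].
Nothing here is a statement of H. Hironaka's manuscript [claim: Hironaka2017, status: under-review]; OUR lemmas about OUR numbers
`WildMonic.dStar` / `dInit` (…WildMonicKangarooDefs) of a monic tuple.]

THE SETTING (letters `x ≠ y`, `w x = 1`, `w y = n ≥ 1`, `t ≠ 0`).  `A` is the tuple in the coordinates `(x, y)` (for the kangaroo: the chart
coordinates after the point step), `B_j = A_j(x, y₁ − t xⁿ)` (`subst (twist x y n t)`) the same tuple in the coordinates `(x, y₁)` subordinate to the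
flag curve `y + t xⁿ = 0`, `m = wMin w A = wMin w B < ⊤`, `g` a re-centring in the subordinate coordinates with `d!·ord_w g ≥ m`, `B̃ = shift d B g`.
* `slotWOrd_twist`, `wMin_twist` — the twist keeps every scaled slot order (`weightedOrder_subst_twist`).
* `mul_spread_le_dInit` / `mul_yOrd_inW_twist_le_dInit` — (∗): for an attaining slot `j` with flattening `P_j` of `in_w(A_j)`,
  `s_j·(deg P_j − tdeg P_j) ≤ dInit` (two initial Newton points of the slot, `apply_sub_apply_le_dGen_of_eqWeight`) and hence
  `s_j · ord_{(y₁)} in_w(B_j) = s_j · tdeg P_j(Y − t) ≤ dInit` (`natTrailingDegree_taylor_add_le`); so `dStar y w B ≤ dInit w (newtonSet A)`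
  (`dStar_twist_le_dInit` — Perlega's `d₁ ≤ d`).
* `dStar_shift_le_of_lt` — CASE `d!·ord_w g > m`: every attaining slot keeps its initial form, `d_*(B̃) ≤ d_*(B) ≤ dInit`.
* `dStar_shift_le_of_caseOne` — CASE `d!·ord_w g = m`, `(1)_w`: the largest attaining slot above `d − q` keeps its form; `d_*(B̃) ≤ dInit`.
* `dStar_shift_le_of_not_attains` / `dStar_shift_le_dStar_of_eq` — CASE `d!·ord_w g = m` through the `ỹ`-valuation: comparing `d!·ord_{(y)} in_w(g)`
  with `d_*(B)` (slot `d − q` carries `C(d,q)·in_w(g)^q`, resp. the `ỹ`-minimal slot keeps its `y`-order), `d_*(B̃) ≤ d_*(B)` whenever no slot above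
  `d − q` attains and either the slot `d − q` does not attain or `d_*(B) < d!·ord_{(y)} in_w(g)`.
The wild case `(3)_w` (Hasse derivatives) and the assembled Prop. 6.2.3 (2)/(4) are in the sibling `…WildMonicKangarooBound`.
AI-written; gate-accepted means sorry-free with standard axioms, not refereed.
-/

set_option linter.dupNamespace false -- mandated namespace of this single-conjunct summit

noncomputable section

namespace Summit.ResolutionOfSingularities.ResolutionOfSingularities.Theorems

namespace WildMonic

open MvPowerSeries MonicDescent Polynomial

variable {k : Type} [Field k]

/-! ## The twisted tuple has the same scaled slot orders -/

section Twist

variable {x y : Fin 2} (hxy : x ≠ y) {w : Fin 2 → ℕ} {n : ℕ} (hwx : w x = 1) (hwy : w y = n) (hn : 1 ≤ n) (t : k)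
  {d : ℕ} (A : Fin d → MvPowerSeries (Fin 2) k)

include hxy hwx hwy hn in
/-- The twist keeps every scaled slot order. -/
theorem slotWOrd_twist (j : Fin d) : slotWOrd w (fun j => subst (twist x y n t) (A j)) j = slotWOrd w A j := by
  unfold slotWOrd
  by_cases hA : A j = 0
  · simp only [hA]
    rw [← substAlgHom_apply (hasSubst_twist x y hn t), map_zero]
  · simp only
    rw [weightedOrder_subst_twist hxy hwx hwy hn t hA]

include hxy hwx hwy hn in
/-- The twist keeps `m`. -/
theorem wMin_twist : wMin w (fun j => subst (twist x y n t) (A j)) = wMin w A := by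
  unfold wMin; exact iInf_congr fun j => slotWOrd_twist hxy hwx hwy hn t A j

end Twist

/-! ## (∗): the spread of an attaining slot is bounded by `dInit` -/

section Star

variable {x y : Fin 2} (hxy : x ≠ y) {w : Fin 2 → ℕ} {n : ℕ} (hwx : w x = 1) (hwy : w y = n) (hn : 1 ≤ n)
  {d : ℕ} (A : Fin d → MvPowerSeries (Fin 2) k)

include hxy hwx hwy hn in
/-- (∗) ON THE CHART SIDE: for a slot `j` attaining `m < ⊤`, with `P` the flattening of `in_w(A_j)` (weight `W = ord_w A_j`),
`s_j · (deg P − tdeg P) ≤ dInit w (newtonSet A)` — the top and bottom initial exponents of the slot are initial Newton points of equal weight. -/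
theorem mul_spread_le_dInit {m : ℕ} (hm : wMin w A = m) {j : Fin d} (hj : slotWOrd w A j = wMin w A) {W : ℕ}
    (hW : ((A j).weightedOrder w).toNat = W) :
    slotWeight d j * ((flatPoly x y n W (inW w (A j))).natDegree - (flatPoly x y n W (inW w (A j))).natTrailingDegree) ≤
      dInit w (newtonSet A) := by
  have hm' : wMin w A ≠ ⊤ := by rw [hm]; exact ENat.coe_ne_top m
  obtain ⟨hAj, -, -, -⟩ := exists_weightedOrder_eq_of_attains w A hj hm'
  have hhom : IsWeightedHomogeneous w (inW w (A j)) W := by rw [← hW]; exact isWeightedHomogeneous_inW w (A j)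
  have hP0 : flatPoly x y n W (inW w (A j)) ≠ 0 :=
    fun h => inW_ne_zero w hAj ((flatPoly_eq_zero_iff hxy hwx hwy hn hhom).mp h)
  set P := flatPoly x y n W (inW w (A j)) with hPdef
  -- the two extreme exponents are in the support of the initial form
  have htop := (mem_support_flatPoly_iff (x := x) (y := y) (W := W) (G := inW w (A j)) hn P.natDegree).mp
    (natDegree_mem_support_of_nonzero hP0)
  have hbot := (mem_support_flatPoly_iff (x := x) (y := y) (W := W) (G := inW w (A j)) hn P.natTrailingDegree).mp
    (natTrailingDegree_mem_support_of_nonzero hP0)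
  have etop := (coeff_inW_ne_zero_iff w (A j) _).mp htop.2
  have ebot := (coeff_inW_ne_zero_iff w (A j) _).mp hbot.2
  have hS : ∀ R ∈ initPts w (newtonSet A), Finsupp.weight w R = m := fun R hR => weight_eq_of_mem_initPts_newtonSet w A hm hR
  have h := apply_sub_apply_le_dGen_of_eqWeight hxy hwx hwy hn hS (smul_mem_initPts_newtonSet w A hm hj etop)
    (smul_mem_initPts_newtonSet w A hm hj ebot)
  rw [Finsupp.smul_apply, Finsupp.smul_apply, single_add_single_apply_y hxy, single_add_single_apply_y hxy, smul_eq_mul, smul_eq_mul,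
    ← Nat.mul_sub] at h
  rw [dInit_eq]
  exact h

include hxy hwx hwy hn in
/-- THE FLATTENED `y₁`-ORDER OF A TWISTED INITIAL FORM: `ord_{(y)} in_w(B_j) = tdeg P_j(Y − t)` for `A_j ≠ 0`, `P_j` the flattening of `in_w(A_j)`. -/
theorem yOrd_inW_twist_eq (t : k) {j : Fin d} (hAj : A j ≠ 0) {W : ℕ} (hW : ((A j).weightedOrder w).toNat = W) :
    (inW w (subst (twist x y n t) (A j))).weightedOrder (Pi.single y 1) =
      ((taylor (-t) (flatPoly x y n W (inW w (A j)))).natTrailingDegree : ℕ) := by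
  have hB0 : subst (twist x y n t) (A j) ≠ 0 := subst_twist_ne_zero hxy hwx hwy hn t hAj
  have hWB : ((subst (twist x y n t) (A j)).weightedOrder w).toNat = W := by rw [weightedOrder_subst_twist hxy hwx hwy hn t hAj, hW]
  have hhomB : IsWeightedHomogeneous w (inW w (subst (twist x y n t) (A j))) W := by
    rw [← hWB]; exact isWeightedHomogeneous_inW w _
  rw [weightedOrder_single_eq_natTrailingDegree hxy hwx hwy hn hhomB (inW_ne_zero w hB0), flatPoly_inW_subst_twist hxy hwx hwy hn t hAj hW]

include hxy hwx hwy hn in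
/-- (∗) ON THE SUBORDINATE SIDE: for a slot `j` attaining `m < ⊤`, `s_j · ord_{(y)} in_w(B_j) ≤ dInit w (newtonSet A)` (`t ≠ 0`; Perlega:
«`ord_{(y₁)} in_w(f_i) ≤ d(in_w(f_i)) ≤ ((c−i)/c!)·d`»). -/
theorem mul_yOrd_inW_twist_le_dInit {t : k} (ht : t ≠ 0) {m : ℕ} (hm : wMin w A = m) {j : Fin d} (hj : slotWOrd w A j = wMin w A) :
    (slotWeight d j : ℕ∞) * (inW w (subst (twist x y n t) (A j))).weightedOrder (Pi.single y 1) ≤ (dInit w (newtonSet A) : ℕ) := by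
  have hm' : wMin w A ≠ ⊤ := by rw [hm]; exact ENat.coe_ne_top m
  obtain ⟨hAj, W, hWj, -⟩ := exists_weightedOrder_eq_of_attains w A hj hm'
  have hW : ((A j).weightedOrder w).toNat = W := by rw [hWj, ENat.toNat_coe]
  have hhom : IsWeightedHomogeneous w (inW w (A j)) W := by rw [← hW]; exact isWeightedHomogeneous_inW w (A j)
  have hP0 : flatPoly x y n W (inW w (A j)) ≠ 0 :=
    fun h => inW_ne_zero w hAj ((flatPoly_eq_zero_iff hxy hwx hwy hn hhom).mp h)
  rw [yOrd_inW_twist_eq hxy hwx hwy hn A t hAj hW, ← Nat.cast_mul, Nat.cast_le]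
  refine le_trans ?_ (mul_spread_le_dInit hxy hwx hwy hn A hm hj hW)
  apply Nat.mul_le_mul_left
  have h := natTrailingDegree_taylor_add_le (neg_ne_zero.mpr ht) hP0
  omega

end Star

/-! ## `d_*` is attained at a slot; `d_*(B) ≤ dInit` -/

section DStar

variable (y : Fin 2) (w : Fin 2 → ℕ) {d : ℕ} (B : Fin d → MvPowerSeries (Fin 2) k)

/-- `d_*` is attained at some attaining slot (finite `m`). -/
theorem exists_attains_dStar_eq (hm : wMin w B ≠ ⊤) :
    ∃ j : Fin d, slotWOrd w B j = wMin w B ∧ dStar y w B = (slotWeight d j : ℕ∞) * (inW w (B j)).weightedOrder (Pi.single y 1) := by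
  classical
  set S := (Finset.univ : Finset (Fin d)).filter (fun j => slotWOrd w B j = wMin w B) with hS
  have hSne : S.Nonempty := by
    obtain ⟨j, hj⟩ := exists_slotWOrd_eq_wMin w B (pos_of_wMin_ne_top w B hm)
    exact ⟨j, Finset.mem_filter.mpr ⟨Finset.mem_univ j, hj⟩⟩
  obtain ⟨j₀, hj₀, hmin⟩ := S.exists_min_image (fun j => (slotWeight d j : ℕ∞) * (inW w (B j)).weightedOrder (Pi.single y 1)) hSne
  refine ⟨j₀, (Finset.mem_filter.mp hj₀).2, le_antisymm (dStar_le y w B (Finset.mem_filter.mp hj₀).2) ?_⟩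
  exact le_dStar y w B fun j hj => hmin j (Finset.mem_filter.mpr ⟨Finset.mem_univ j, hj⟩)

/-- If some slot of the re-centred tuple has scaled order `m` (and `d!·ord_w g ≥ m`), the re-centred tuple has `wMin = m`. -/
theorem wMin_shift_eq_of_slot (g : MvPowerSeries (Fin 2) k) (hG : wMin w B ≤ (d.factorial : ℕ∞) * g.weightedOrder w) {j : Fin d}
    (hatt : slotWOrd w (shift d B g) j = wMin w B) : wMin w (shift d B g) = wMin w B :=
  le_antisymm (by rw [← hatt]; exact wMin_le_slotWOrd w _ j) (wMin_le_wMin_shift w B g hG)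

/-- … so that slot attains the new `wMin`. -/
theorem attains_shift_of_slot (g : MvPowerSeries (Fin 2) k) (hG : wMin w B ≤ (d.factorial : ℕ∞) * g.weightedOrder w) {j : Fin d}
    (hatt : slotWOrd w (shift d B g) j = wMin w B) : slotWOrd w (shift d B g) j = wMin w (shift d B g) := by
  rw [wMin_shift_eq_of_slot w B g hG hatt]; exact hatt

end DStar

section Cases

variable {x y : Fin 2} (hxy : x ≠ y) {w : Fin 2 → ℕ} {n : ℕ} (hwx : w x = 1) (hwy : w y = n) (hn : 1 ≤ n) {t : k} (ht : t ≠ 0)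
  {d : ℕ} (A : Fin d → MvPowerSeries (Fin 2) k) (g : MvPowerSeries (Fin 2) k)

include hxy hwx hwy hn ht in
/-- PERLEGA'S `d₁ ≤ d`: `d_*` of the twisted tuple is at most `dInit` of the chart tuple. -/
theorem dStar_twist_le_dInit {m : ℕ} (hm : wMin w A = m) :
    dStar y w (fun j => subst (twist x y n t) (A j)) ≤ (dInit w (newtonSet A) : ℕ) := by
  have hm' : wMin w A ≠ ⊤ := by rw [hm]; exact ENat.coe_ne_top m
  obtain ⟨j, hj⟩ := exists_slotWOrd_eq_wMin w A (pos_of_wMin_ne_top w A hm')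
  have hjB : slotWOrd w (fun j => subst (twist x y n t) (A j)) j = wMin w (fun j => subst (twist x y n t) (A j)) := by
    rw [slotWOrd_twist hxy hwx hwy hn t A j, wMin_twist hxy hwx hwy hn t A, hj]
  exact (dStar_le y w _ hjB).trans (mul_yOrd_inW_twist_le_dInit hxy hwx hwy hn A ht hm hj)

include hxy hwx hwy hn ht in
/-- CASE `d!·ord_w g > m`: every attaining slot keeps its initial form, so `d_*(B̃) ≤ dInit` (indeed `≤ d_*(B)`; Perlega: «if `f` is `ỹ`-clean …
`d_* = d₁ ≤ d`», Lemma 5.1.1 (2)). -/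
theorem dStar_shift_le_of_lt {m : ℕ} (hm : wMin w A = m)
    (hG : wMin w A < (d.factorial : ℕ∞) * g.weightedOrder w) :
    dStar y w (shift d (fun j => subst (twist x y n t) (A j)) g) ≤ (dInit w (newtonSet A) : ℕ) := by
  have hm' : wMin w A ≠ ⊤ := by rw [hm]; exact ENat.coe_ne_top m
  set B : Fin d → MvPowerSeries (Fin 2) k := fun j => subst (twist x y n t) (A j) with hBdef
  have hmB : wMin w B = wMin w A := wMin_twist hxy hwx hwy hn t A
  obtain ⟨j, hj⟩ := exists_slotWOrd_eq_wMin w A (pos_of_wMin_ne_top w A hm')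
  have hjB : slotWOrd w B j = wMin w B := by rw [hBdef, slotWOrd_twist hxy hwx hwy hn t A j, hmB, hj]
  have hGB : wMin w B < (d.factorial : ℕ∞) * g.weightedOrder w := by rw [hmB]; exact hG
  obtain ⟨hatt, hin⟩ := inW_shift_eq_of_kept w B g j hjB (by rw [hmB]; exact hm') hGB.le (fun j' _ => Or.inr hGB)
    (lt_of_lt_of_le hGB (le_slotWeight_mul_weightedOrder_top w g j))
  calc dStar y w (shift d B g) ≤ (slotWeight d j : ℕ∞) * (inW w (shift d B g j)).weightedOrder (Pi.single y 1) :=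
        dStar_le y w _ (attains_shift_of_slot w B g hGB.le hatt)
    _ = (slotWeight d j : ℕ∞) * (inW w (B j)).weightedOrder (Pi.single y 1) := by rw [hin]
    _ ≤ (dInit w (newtonSet A) : ℕ) := mul_yOrd_inW_twist_le_dInit hxy hwx hwy hn A ht hm hj

variable (p : ℕ) [Fact p.Prime] [CharP k p]

include hxy hwx hwy hn ht in
/-- CASE `d!·ord_w g = m`, `(1)_w`: the LARGEST slot above `d − q` that attains `m` keeps its initial form (the slots above it do not attain, and its
top coefficient `C(d,i) g^{d−i}` vanishes by Lemma (c−q)); so `d_*(B̃) ≤ dInit` (Perlega, Prop. 6.2.3 proof, case `(1)_w`). -/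
theorem dStar_shift_le_of_caseOne {m : ℕ} (hm : wMin w A = m) (heq : wMin w A = (d.factorial : ℕ∞) * g.weightedOrder w)
    (h1 : ∃ i : Fin d, d - qOf p d < (i : ℕ) ∧ slotWOrd w A i = wMin w A) :
    dStar y w (shift d (fun j => subst (twist x y n t) (A j)) g) ≤ (dInit w (newtonSet A) : ℕ) := by
  classical
  have hm' : wMin w A ≠ ⊤ := by rw [hm]; exact ENat.coe_ne_top m
  set B : Fin d → MvPowerSeries (Fin 2) k := fun j => subst (twist x y n t) (A j) with hBdef
  have hmB : wMin w B = wMin w A := wMin_twist hxy hwx hwy hn t A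
  have hslotB : ∀ j, slotWOrd w B j = slotWOrd w A j := fun j => by rw [hBdef, slotWOrd_twist hxy hwx hwy hn t A j]
  -- the largest attaining slot above `d − q`
  set S : Finset (Fin d) := Finset.univ.filter (fun i : Fin d => d - qOf p d < (i : ℕ) ∧ slotWOrd w A i = wMin w A) with hS
  have hSne : S.Nonempty := by obtain ⟨i, hi⟩ := h1; exact ⟨i, Finset.mem_filter.mpr ⟨Finset.mem_univ i, hi⟩⟩
  obtain ⟨i, hiS, hmax⟩ := S.exists_max_image (fun i : Fin d => (i : ℕ)) hSne
  obtain ⟨hiq, hi⟩ := (Finset.mem_filter.mp hiS).2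
  have hiB : slotWOrd w B i = wMin w B := by rw [hslotB, hmB, hi]
  have hlater : ∀ j : Fin d, (i : ℕ) < j → wMin w B < slotWOrd w B j ∨ wMin w B < (d.factorial : ℕ∞) * g.weightedOrder w := by
    intro j hij
    left
    rw [hslotB, hmB]
    refine lt_of_le_of_ne (wMin_le_slotWOrd w A j) fun h => ?_
    have hjS : j ∈ S := Finset.mem_filter.mpr ⟨Finset.mem_univ j, by omega, h.symm⟩
    exact absurd (hmax j hjS) (not_le.mpr hij)
  have htop : wMin w B < (slotWeight d i : ℕ∞) *
      (((d.choose i : ℕ) : MvPowerSeries (Fin 2) k) * g ^ (d - (i : ℕ))).weightedOrder w := by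
    rw [shift_top_eq_zero_of_gt (k := k) g p hiq, weightedOrder_zero, ENat.mul_top (by exact_mod_cast (slotWeight_pos i).ne'), hmB]
    exact lt_top_iff_ne_top.mpr hm'
  obtain ⟨hatt, hin⟩ := inW_shift_eq_of_kept w B g i hiB (by rw [hmB]; exact hm') (by rw [hmB]; exact heq.le) hlater htop
  calc dStar y w (shift d B g) ≤ (slotWeight d i : ℕ∞) * (inW w (shift d B g i)).weightedOrder (Pi.single y 1) :=
        dStar_le y w _ (attains_shift_of_slot w B g (by rw [hmB]; exact heq.le) hatt)
    _ = (slotWeight d i : ℕ∞) * (inW w (B i)).weightedOrder (Pi.single y 1) := by rw [hin]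
    _ ≤ (dInit w (newtonSet A) : ℕ) := mul_yOrd_inW_twist_le_dInit hxy hwx hwy hn A ht hm hi

include hxy hwx hwy hn ht in
/-- CASE `d!·ord_w g = m` and `d_*(B) < d!·ord_{(y)} in_w(g)`: the `ỹ`-minimal attaining slot keeps its `y`-order, so `d_*(B̃) ≤ d_*(B) ≤ dInit`
(valuation form of Lemma 5.1.1 (2) for `ỹ`; no cleanness needed). -/
theorem dStar_shift_le_dStar_of_yMin {m : ℕ} (hm : wMin w A = m) (heq : wMin w A = (d.factorial : ℕ∞) * g.weightedOrder w)
    (hgy : dStar y w (fun j => subst (twist x y n t) (A j)) < (d.factorial : ℕ∞) * (inW w g).weightedOrder (Pi.single y 1)) :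
    dStar y w (shift d (fun j => subst (twist x y n t) (A j)) g) ≤ (dInit w (newtonSet A) : ℕ) := by
  have hm' : wMin w A ≠ ⊤ := by rw [hm]; exact ENat.coe_ne_top m
  set B : Fin d → MvPowerSeries (Fin 2) k := fun j => subst (twist x y n t) (A j) with hBdef
  have hmB : wMin w B = wMin w A := wMin_twist hxy hwx hwy hn t A
  have hslotB : ∀ j, slotWOrd w B j = slotWOrd w A j := fun j => by rw [hBdef, slotWOrd_twist hxy hwx hwy hn t A j]
  have hmB' : wMin w B ≠ ⊤ := by rw [hmB]; exact hm'
  obtain ⟨i, hi, hD⟩ := exists_attains_dStar_eq y w B hmB'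
  obtain ⟨hatt, hyeq⟩ := slot_attains_and_yOrd_eq_of_yMin w B g y i hi hmB' (by rw [hmB]; exact heq)
    (fun j _ hj => by rw [← hD]; exact dStar_le y w B hj) (by rw [← hD]; exact hgy)
  have hiA : slotWOrd w A i = wMin w A := by rw [← hslotB, hi, hmB]
  calc dStar y w (shift d B g) ≤ (slotWeight d i : ℕ∞) * (inW w (shift d B g i)).weightedOrder (Pi.single y 1) :=
        dStar_le y w _ (attains_shift_of_slot w B g (by rw [hmB]; exact heq.le) hatt)
    _ = (slotWeight d i : ℕ∞) * (inW w (B i)).weightedOrder (Pi.single y 1) := by rw [hyeq]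
    _ ≤ (dInit w (newtonSet A) : ℕ) := mul_yOrd_inW_twist_le_dInit hxy hwx hwy hn A ht hm hiA

include hxy hwx hwy hn ht in
/-- CASE `d!·ord_w g = m`, no slot above `d − q` attains, the slot `d − q` does NOT attain (`(2)_w`), and `d!·ord_{(y)} in_w(g) ≤ d_*(B)`: the slot
`d − q` of `B̃` carries `C(d,q)·in_w(g)^q` (Lemma 5.1.2 (ii)) and gives `d_*(B̃) ≤ d!·ord_{(y)} in_w(g) ≤ d_*(B) ≤ dInit`. -/
theorem dStar_shift_le_of_not_attains {m : ℕ} (hm : wMin w A = m) (heq : wMin w A = (d.factorial : ℕ∞) * g.weightedOrder w)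
    (hno : ∀ j : Fin d, d - qOf p d < (j : ℕ) → wMin w A < slotWOrd w A j)
    {i : Fin d} (hiq : (i : ℕ) = d - qOf p d) (h2 : wMin w A < slotWOrd w A i)
    (hgy : (d.factorial : ℕ∞) * (inW w g).weightedOrder (Pi.single y 1) ≤ dStar y w (fun j => subst (twist x y n t) (A j))) :
    dStar y w (shift d (fun j => subst (twist x y n t) (A j)) g) ≤ (dInit w (newtonSet A) : ℕ) := by
  have hm' : wMin w A ≠ ⊤ := by rw [hm]; exact ENat.coe_ne_top m
  have hd : 0 < d := Fin.pos i
  set B : Fin d → MvPowerSeries (Fin 2) k := fun j => subst (twist x y n t) (A j) with hBdef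
  have hmB : wMin w B = wMin w A := wMin_twist hxy hwx hwy hn t A
  have hslotB : ∀ j, slotWOrd w B j = slotWOrd w A j := fun j => by rw [hBdef, slotWOrd_twist hxy hwx hwy hn t A j]
  have hmB' : wMin w B ≠ ⊤ := by rw [hmB]; exact hm'
  have heqB : wMin w B = (d.factorial : ℕ∞) * g.weightedOrder w := by rw [hmB]; exact heq
  have hg : g ≠ 0 := ne_zero_of_factorial_mul_eq w B g hmB' heqB
  -- `V = q · ord_w g` with `s_{d−q} · V = m`
  have hgfin : g.weightedOrder w ≠ ⊤ := (weightedOrder_eq_top_iff w).not.mpr hg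
  set γ := (g.weightedOrder w).toNat with hγ
  have hγeq : g.weightedOrder w = γ := (ENat.coe_toNat hgfin).symm
  have hq : d - (i : ℕ) = qOf p d := by have := Nat.le_of_dvd hd (qOf_dvd p d); omega
  have hV : (slotWeight d i : ℕ∞) * ((qOf p d * γ : ℕ) : ℕ∞) = wMin w B := by
    rw [heqB, hγeq, Nat.cast_mul, ← mul_assoc, ← Nat.cast_mul, ← hq, slotWeight_mul_sub]
  -- the component of `B_{d−q}` vanishes (the slot does not attain)
  have hcomp0 : weightedHomogeneousComponent w (qOf p d * γ) (B i) = 0 := by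
    apply component_eq_zero_of_lt w
    refine lt_of_slotWeight_mul_lt i ?_
    rw [hV]
    show wMin w B < slotWOrd w B i
    rw [hslotB, hmB]; exact h2
  have hcne : ((d.choose i : ℕ) : k) ≠ 0 := by
    rw [← Nat.choose_symm i.2.le, hq]; exact natCast_choose_qOf_ne_zero (k := k) p hd
  have hH : weightedHomogeneousComponent w (qOf p d * γ) (B i) +
      MvPowerSeries.C ((d.choose i : ℕ) : k) * (inW w g) ^ (d - (i : ℕ)) ≠ 0 := by
    rw [hcomp0, zero_add]
    exact mul_ne_zero (fun h => hcne (by simpa using congrArg MvPowerSeries.constantCoeff h)) (pow_ne_zero _ (inW_ne_zero w hg))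
  obtain ⟨hatt, hin⟩ := inW_shift_slot_sub_qOf w B g p hiq hmB' heqB (fun j hj => by rw [hslotB, hmB]; exact hno j hj) hV hH
  rw [hcomp0, zero_add] at hin
  calc dStar y w (shift d B g) ≤ (slotWeight d i : ℕ∞) * (inW w (shift d B g i)).weightedOrder (Pi.single y 1) :=
        dStar_le y w _ (attains_shift_of_slot w B g heqB.le hatt)
    _ = (d.factorial : ℕ∞) * (inW w g).weightedOrder (Pi.single y 1) := by
        rw [hin, weightedOrder_C_mul_of_ne_zero _ hcne, weightedOrder_pow_eq, ← mul_assoc, ← Nat.cast_mul, hq, ← hq, slotWeight_mul_sub]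
    _ ≤ dStar y w B := hgy
    _ ≤ (dInit w (newtonSet A) : ℕ) := dStar_twist_le_dInit hxy hwx hwy hn ht A hm

end Cases

end WildMonic

end Summit.ResolutionOfSingularities.ResolutionOfSingularities.Theorems

end
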